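/-
Copyright: derived here (Resolution Observatory cell `pub-rosobs`, carver gen 50). AI-written Lean; AI review is
weaker than expert review.  Companion file of the cell's POLYNOMIAL weighted-centre model `W(f)`: the identity core
of engine 1's LEMMA Λ₄ (b) "(ε)-adic filtration" (THEOREM-FQ-eng1-g34 §13; CARVER-NOTES-eng1-g34 T18 (b)).
Instrument — NOT a resolution theorem and NOT a statement about the invariant of [AbramovichTemkinWlodarczyk2024].
-/
import Mathlib.Algebra.MvPolynomial.CommRing
import Mathlib.RingTheory.Ideal.Maps
import HarnessLib

/-!
# Endomorphisms preserving an adic filtration act on the graded pieces through their first-order part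

§1 (any commutative ring `S`, any ideal `I`).  Ring endomorphisms `φ, ψ` of `S` mapping `I` into `I` preserve every
`Iⁿ` (`map_mem_pow_of_forall_mem`); if moreover `φ ≡ ψ (mod I)` everywhere and `φ ≡ ψ (mod I²)` on `I`
("same first-order part"), then `φ f − ψ f ∈ Iⁿ⁺¹` for every `f ∈ Iⁿ` (`sub_mem_pow_succ`): `φ` and `ψ` induce the
SAME map on each graded piece `Iⁿ/Iⁿ⁺¹`.

§2 (`S = R[ε_ι] = MvPolynomial ι R`, `I = (ε) = span {ε_i}`, `R`-algebra endomorphisms — in the cell `R = k[σ]`, so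
these are the `k[σ]`-algebra endomorphisms of `k[σ][ε]`).  The hypotheses are checked on the generators:
`φ(ε_i) ∈ (ε)` for all `i` ⇒ `φ` preserves the `(ε)`-adic filtration (`algHom_mem_varsIdeal_pow`); two such
endomorphisms with `φ(ε_i) − ψ(ε_i) ∈ (ε)²` agree on every `(ε)ⁿ/(ε)ⁿ⁺¹` (`algHom_sub_mem_varsIdeal_pow_succ`).
In particular (**Λ₄ (b)**, T18 (b)) the unipotent substitution `ε_i ↦ ε_i + A_i`, `A_i ∈ (ε)`, preserves the
filtration and acts on `gr_{(ε)}` like its linear truncation `ε_i ↦ ε_i + A_i^{(1)}` (any `ψ` with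
`ψ(ε_i) ≡ ε_i + A_i (mod (ε)²)`), and like the identity when `A_i ∈ (ε)²` (`aeval_sub_self_mem_varsIdeal_pow_succ`).

Elementary commutative algebra; formalisation ours.  [ATW24] Abramovich–Temkin–Włodarczyk, Algebra & Number Theory
18 (2024), Thm. 5.3.1 (2)–(3) (p. 1578): CONTEXT ONLY (graded automorphisms of the graded algebra of the centre).
-/

namespace Literature.AlgebraicGeometry.Resolution.WeightedBlowup

/-! ## §1 Abstract: an ideal `I` of a commutative ring and endomorphisms preserving it -/

section Abstract

variable {S : Type*} [CommRing S] (I : Ideal S)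

/-- An endomorphism mapping `I` into `I` maps `Iⁿ` into `Iⁿ` (elementary; ours).
[cite: AbramovichTemkinWlodarczyk2024, Thm. 5.3.1 (2)–(3) (p. 1578)] -/
theorem map_mem_pow_of_forall_mem (ψ : S →+* S) (hψ : ∀ x ∈ I, ψ x ∈ I) {n : ℕ} {x : S} (hx : x ∈ I ^ n) :
    ψ x ∈ I ^ n := by
  have hle : I.map ψ ≤ I := Ideal.map_le_iff_le_comap.mpr fun y hy => Ideal.mem_comap.mpr (hψ y hy)
  have h := Ideal.mem_map_of_mem ψ hx
  rw [Ideal.map_pow] at h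
  exact Ideal.pow_right_mono hle n h

/-- **Same first-order part ⇒ same action on the graded pieces.**  If `φ, ψ` map `I` into `I`, `φ ≡ ψ (mod I)`
on `S` and `φ ≡ ψ (mod I²)` on `I`, then `φ f − ψ f ∈ Iⁿ⁺¹` for all `f ∈ Iⁿ` (elementary; ours: induction on `n`
with `φ(ab) − ψ(ab) = φ(a)(φ b − ψ b) + (φ a − ψ a)ψ(b)`).
[cite: AbramovichTemkinWlodarczyk2024, Thm. 5.3.1 (2)–(3) (p. 1578)] -/
theorem sub_mem_pow_succ (φ ψ : S →+* S) (hφ : ∀ x ∈ I, φ x ∈ I) (hψ : ∀ x ∈ I, ψ x ∈ I)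
    (h0 : ∀ x, φ x - ψ x ∈ I) (h1 : ∀ x ∈ I, φ x - ψ x ∈ I ^ 2) (n : ℕ) {f : S} (hf : f ∈ I ^ n) :
    φ f - ψ f ∈ I ^ (n + 1) := by
  induction n generalizing f with
  | zero => simpa only [zero_add, pow_one] using h0 f
  | succ n ih =>
    rw [pow_succ'] at hf
    refine Submodule.mul_induction_on hf (fun a ha b hb => ?_) (fun a b ha' hb' => ?_)
    · have : φ (a * b) - ψ (a * b) = φ a * (φ b - ψ b) + (φ a - ψ a) * ψ b := by
        rw [map_mul, map_mul]; ring
      rw [this]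
      refine Ideal.add_mem _ ?_ ?_
      · rw [pow_succ']
        exact Ideal.mul_mem_mul (hφ a ha) (ih hb)
      · have h := Ideal.mul_mem_mul (h1 a ha) (map_mem_pow_of_forall_mem I ψ hψ hb)
        rw [← pow_add] at h
        rwa [show n + 1 + 1 = 2 + n by ring]
    · rw [map_add, map_add, add_sub_add_comm]
      exact Ideal.add_mem _ ha' hb'

end Abstract

/-! ## §2 The `(ε)`-adic filtration of `R[ε_ι]` and `R`-algebra endomorphisms -/

section Vars

open MvPolynomial

variable {R : Type*} [CommRing R] {ι : Type*}

/-- An `R`-algebra endomorphism of `R[ε]` with `ψ(ε_i) ∈ (ε)` for all `i` maps `(ε)` into `(ε)` (ours; the ideal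
is generated by the `ε_i`). [cite: AbramovichTemkinWlodarczyk2024, Thm. 5.3.1 (2)–(3) (p. 1578)] -/
theorem algHom_mem_varsIdeal (ψ : MvPolynomial ι R →ₐ[R] MvPolynomial ι R)
    (hψ : ∀ i, ψ (X i) ∈ Ideal.span (Set.range (X : ι → MvPolynomial ι R))) {x : MvPolynomial ι R}
    (hx : x ∈ Ideal.span (Set.range (X : ι → MvPolynomial ι R))) :
    ψ x ∈ Ideal.span (Set.range (X : ι → MvPolynomial ι R)) := by
  have hle : (Ideal.span (Set.range (X : ι → MvPolynomial ι R))).map ψ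
      ≤ Ideal.span (Set.range (X : ι → MvPolynomial ι R)) := by
    rw [Ideal.map_span, Ideal.span_le]
    rintro _ ⟨_, ⟨i, rfl⟩, rfl⟩
    exact hψ i
  exact hle (Ideal.mem_map_of_mem ψ hx)

/-- **Filtration preserved** (Λ₄ (b), first half): `ψ(ε_i) ∈ (ε)` for all `i` ⇒ `ψ((ε)ⁿ) ⊆ (ε)ⁿ` (ours).
[cite: AbramovichTemkinWlodarczyk2024, Thm. 5.3.1 (2)–(3) (p. 1578)] -/
theorem algHom_mem_varsIdeal_pow (ψ : MvPolynomial ι R →ₐ[R] MvPolynomial ι R)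
    (hψ : ∀ i, ψ (X i) ∈ Ideal.span (Set.range (X : ι → MvPolynomial ι R))) {n : ℕ} {x : MvPolynomial ι R}
    (hx : x ∈ Ideal.span (Set.range (X : ι → MvPolynomial ι R)) ^ n) :
    ψ x ∈ Ideal.span (Set.range (X : ι → MvPolynomial ι R)) ^ n :=
  map_mem_pow_of_forall_mem _ (ψ : MvPolynomial ι R →+* MvPolynomial ι R)
    (fun _ hy => algHom_mem_varsIdeal ψ hψ hy) hx

/-- Two `R`-algebra endomorphisms of `R[ε]` whose values on the `ε_i` differ by elements of an ideal `J` are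
congruent `mod J` everywhere (ours; `{f | φ f − ψ f ∈ J}` contains `R` and the `ε_i` and is closed under `+`, `·ε_i`).
[cite: AbramovichTemkinWlodarczyk2024, Thm. 5.3.1 (2)–(3) (p. 1578)] -/
theorem algHom_sub_mem_of_forall_X (J : Ideal (MvPolynomial ι R)) (φ ψ : MvPolynomial ι R →ₐ[R] MvPolynomial ι R)
    (h : ∀ i, φ (X i) - ψ (X i) ∈ J) (f : MvPolynomial ι R) : φ f - ψ f ∈ J := by
  induction f using MvPolynomial.induction_on with
  | C a => rw [algHom_C, algHom_C, sub_self]; exact J.zero_mem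
  | add p q hp hq => rw [map_add, map_add, add_sub_add_comm]; exact J.add_mem hp hq
  | mul_X p i hp =>
    have : φ (p * X i) - ψ (p * X i) = φ p * (φ (X i) - ψ (X i)) + (φ p - ψ p) * ψ (X i) := by
      rw [map_mul, map_mul]; ring
    rw [this]
    exact J.add_mem (J.mul_mem_left _ (h i)) (J.mul_mem_right _ hp)

/-- **Same linear part ⇒ same action on `gr_{(ε)}`** (Λ₄ (b), second half): if `φ(ε_i), ψ(ε_i) ∈ (ε)` and
`φ(ε_i) − ψ(ε_i) ∈ (ε)²` for all `i`, then `φ f − ψ f ∈ (ε)ⁿ⁺¹` for every `f ∈ (ε)ⁿ` (ours).  With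
`φ(ε_i) = ε_i + A_i` (`A_i ∈ (ε)`) and `ψ(ε_i) = ε_i + A_i^{(1)}` its linear truncation this is CARVER-NOTES T18 (b).
[cite: AbramovichTemkinWlodarczyk2024, Thm. 5.3.1 (2)–(3) (p. 1578)] -/
theorem algHom_sub_mem_varsIdeal_pow_succ (φ ψ : MvPolynomial ι R →ₐ[R] MvPolynomial ι R)
    (hφ : ∀ i, φ (X i) ∈ Ideal.span (Set.range (X : ι → MvPolynomial ι R)))
    (hψ : ∀ i, ψ (X i) ∈ Ideal.span (Set.range (X : ι → MvPolynomial ι R)))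
    (h : ∀ i, φ (X i) - ψ (X i) ∈ Ideal.span (Set.range (X : ι → MvPolynomial ι R)) ^ 2) (n : ℕ)
    {f : MvPolynomial ι R} (hf : f ∈ Ideal.span (Set.range (X : ι → MvPolynomial ι R)) ^ n) :
    φ f - ψ f ∈ Ideal.span (Set.range (X : ι → MvPolynomial ι R)) ^ (n + 1) := by
  set I := Ideal.span (Set.range (X : ι → MvPolynomial ι R)) with hI
  have hle : I ^ 2 ≤ I := Ideal.pow_le_self two_ne_zero
  have h0 : ∀ x, φ x - ψ x ∈ I := algHom_sub_mem_of_forall_X I φ ψ fun i => hle (h i)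
  have h1 : ∀ x ∈ I, φ x - ψ x ∈ I ^ 2 := by
    intro x hx
    refine Submodule.span_induction (p := fun x _ => φ x - ψ x ∈ I ^ 2) ?_ ?_ ?_ ?_ hx
    · rintro _ ⟨i, rfl⟩; exact h i
    · rw [map_zero, map_zero, sub_zero]; exact Ideal.zero_mem _
    · intro x y _ _ hx' hy'; rw [map_add, map_add, add_sub_add_comm]; exact Ideal.add_mem _ hx' hy'
    · intro a x hx' hpx
      have : φ (a • x) - ψ (a • x) = φ a * (φ x - ψ x) + (φ a - ψ a) * ψ x := by
        rw [smul_eq_mul, map_mul, map_mul]; ring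
      rw [this]
      refine Ideal.add_mem _ (Ideal.mul_mem_left _ _ hpx) ?_
      rw [pow_two]
      exact Ideal.mul_mem_mul (h0 a) (algHom_mem_varsIdeal ψ hψ hx')
  exact sub_mem_pow_succ I (φ : MvPolynomial ι R →+* MvPolynomial ι R) ψ
    (fun _ hy => algHom_mem_varsIdeal φ hφ hy) (fun _ hy => algHom_mem_varsIdeal ψ hψ hy) h0 h1 n hf

/-- **Shifts of order ≥ 2 act trivially on `gr_{(ε)}`**: for the substitution `ε_i ↦ ε_i + A_i` with
`A_i ∈ (ε)²`, `f(ε + A) − f ∈ (ε)ⁿ⁺¹` for every `f ∈ (ε)ⁿ` (ours; the case `ψ = id`).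
[cite: AbramovichTemkinWlodarczyk2024, Thm. 5.3.1 (2)–(3) (p. 1578)] -/
theorem aeval_sub_self_mem_varsIdeal_pow_succ (A : ι → MvPolynomial ι R)
    (hA : ∀ i, A i ∈ Ideal.span (Set.range (X : ι → MvPolynomial ι R)) ^ 2) (n : ℕ) {f : MvPolynomial ι R}
    (hf : f ∈ Ideal.span (Set.range (X : ι → MvPolynomial ι R)) ^ n) :
    aeval (fun i => X i + A i) f - f ∈ Ideal.span (Set.range (X : ι → MvPolynomial ι R)) ^ (n + 1) := by
  have hX : ∀ i, (X i : MvPolynomial ι R) ∈ Ideal.span (Set.range (X : ι → MvPolynomial ι R)) :=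
    fun i => Ideal.subset_span ⟨i, rfl⟩
  have h := algHom_sub_mem_varsIdeal_pow_succ (aeval fun i => X i + A i) (AlgHom.id R (MvPolynomial ι R))
    (fun i => by
      rw [aeval_X]
      exact Ideal.add_mem _ (hX i) (Ideal.pow_le_self two_ne_zero (hA i)))
    (fun i => by rw [AlgHom.id_apply]; exact hX i)
    (fun i => by rw [aeval_X, AlgHom.id_apply, add_sub_cancel_left]; exact hA i) n hf
  simpa only [AlgHom.id_apply] using h

end Vars

end Literature.AlgebraicGeometry.Resolution.WeightedBlowup
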